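import Literature.MathematicalPhysics.QuantumLattice.ApproximatingHamiltonianProofs
import Literature.MathematicalPhysics.QuantumLattice.DuhamelEqualTimeBounds
import Summits.HubbardSuperconductivity.HubbardSuperconductivity.Theorems.ThermalWedgeTwSeededEnsembleEquivalenceROfColdDiffUniq
import Summits.HubbardSuperconductivity.HubbardSuperconductivity.Theorems.ThermalWedgeTwSeededEnsembleEquivalenceRDiffOfCompressibility
import Summits.HubbardSuperconductivity.HubbardSuperconductivity.Theorems.ThermalWedgeTwSeededEnsembleEquivalenceRUniqOfStrictConcavity

/-!
# Crux `TwSeededEnsembleEquivalenceR` (stmt-HubbardSuperconductivity-15581), line `cold-floor-collapse`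
# (slug `Sketch`) — DIFF FROM NORMAL NUMBER FLUCTUATIONS (the Gibbs-state form of the physics input)

Support file (`--supports stmt-HubbardSuperconductivity-15581`; sorry-free; no definition).

`…RDiffOfCompressibility` reduced the physics stub DIFF (`stub_sourcedColdDiff`) to E_DIFF, a uniform-in-`L`
bound `M t²` on the symmetric second `μ`-differences of the finite-volume sourced pressure at the cold slice
`β = e^{a/U}`. Here E_DIFF is reduced one step further, to a statement about ONE correlation function of the
finite-volume Gibbs state: the NUMBER VARIANCE per volume,

  VAR_DIFF:  `Re⟨N̂²⟩_{β,L,U,μ',h} − (Re⟨N̂⟩_{β,L,U,μ',h})² ≤ C·L²`  for `μ'` near `μ`, uniformly in large `L`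

(normal density fluctuations = bounded static density structure factor at zero momentum = summable truncated
density–density correlations — the form in which a convergent expansion states "one `μ`-derivative deep").

* `nvc_log_partitionFn_second_difference_le` (any finite-dimensional Gibbs state; Hermitian `K`, `N`, `β > 0`):
  if `Re⟨N²⟩_{K−sN} − (Re⟨N⟩_{K−sN})² ≤ V` for `|s| ≤ t₀` then for `0 < t ≤ t₀`
  `log Z(K−tN) + log Z(K+tN) − 2 log Z(K) ≤ 2β²V t²`. Proof: Peierls–Bogoliubov twice
  (`log_partitionFn_sub_le_log_partitionFn_add` at the two shifted Hamiltonians) bounds the second difference by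
  `βt·(m(t) − m(−t))`, `m(s) = Re⟨N⟩_{K−sN}`; the susceptibility formula `m' = β((N,N)_Duh − m²)`
  (`hasDerivAt_re_gibbsState_source`) with the DLS bound `(N,N)_Duh ≤ ⟨N²⟩` (`re_duhamel_conjTranspose_le`) and
  the mean value inequality give `m(t) − m(−t) ≤ 2βV t`.
* `nvc_sourcedPressure_second_difference_le` — the same for the sourced torus pressure
  `p̃_L(μ) = log Z(dWaveSourceTorus L U μ h)/(βL²)`: variance `≤ C L²` near `μ` ⟹ second differences `≤ 2βC t²`.
* `nvc_compressibility_of_numberVariance` — **VAR_DIFF ⟹ E_DIFF** (same quantifier prefix as the stubs);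
  `nvc_stub_sourcedColdDiff_of_numberVariance` — **VAR_DIFF ⟹ DIFF** (registered signature of
  `stub_sourcedColdDiff` verbatim, via `sdc_stub_sourcedColdDiff_of_compressibility`);
  `twR_of_numberVariance_strictConcavity` — **VAR_DIFF → SCONC → TwSeededEnsembleEquivalenceR**
  (with `usc_stub_sourcedColdUniq_of_strictConcavity` and the lead's `twR_of_coldDiff_coldUniq`).

[folklore composition]
-/

set_option linter.dupNamespace false

namespace Summit.HubbardSuperconductivity.HubbardSuperconductivity.Theorems

open Matrix Set Literature.MathematicalPhysics.QuantumLattice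
open Summit.HubbardSuperconductivity.HubbardSuperconductivity.Theses.ThermalWedge
open Summit.HubbardSuperconductivity.HubbardSuperconductivity.Theorems.TwSeededEnsembleEquivalenceR.ColdFloorLine
open scoped ComplexOrder

noncomputable section

/-! ### Any finite-dimensional Gibbs state: number variance bounds the second difference of `log Z` -/

/-- **Second difference of `log Z` along a source from the variance of the source observable.** For
Hermitian `K`, `N` on a nonempty finite index type and `β > 0`: if the variance
`Re⟨N²⟩_{K−sN} − (Re⟨N⟩_{K−sN})² ≤ V` for all `s ∈ [−t₀, t₀]`, then for `0 < t ≤ t₀`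
`log Z(K − tN) + log Z(K − (−t)N) − 2 log Z(K) ≤ 2β²V t²` (Peierls–Bogoliubov twice + the
susceptibility formula + the DLS bound `(N,N)_Duh ≤ ⟨N²⟩` + the mean value inequality).
[folklore: Bratteli–Robinson II §5.3–5.4; Dyson–Lieb–Simon 1978 eq. (5)] -/
theorem nvc_log_partitionFn_second_difference_le {n : Type*} [Fintype n] [DecidableEq n] [Nonempty n]
    {K N : Matrix n n ℂ} (hK : K.IsHermitian) (hN : N.IsHermitian) {β : ℝ} (hβ : 0 < β) {V t₀ : ℝ}
    (hvar : ∀ s ∈ Set.Icc (-t₀) t₀,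
      (gibbsState β (K - (s : ℂ) • N) (N * N)).re - (gibbsState β (K - (s : ℂ) • N) N).re ^ 2 ≤ V)
    {t : ℝ} (ht : 0 < t) (htt : t ≤ t₀) :
    Real.log (partitionFn β (K - (t : ℂ) • N)).re +
        Real.log (partitionFn β (K - ((-t : ℝ) : ℂ) • N)).re -
      2 * Real.log (partitionFn β K).re ≤ 2 * β ^ 2 * V * t ^ 2 := by
  -- the source magnetisation and its derivative
  set m : ℝ → ℝ := fun s => (gibbsState β (K - (s : ℂ) • N) N).re with hm_def
  have hm' : ∀ s : ℝ, HasDerivAt m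
      (β * ((duhamel β (K - (s : ℂ) • N) N N).re - m s ^ 2)) s := fun s =>
    hasDerivAt_re_gibbsState_source hK hN hβ s
  have hbound : ∀ s ∈ Set.Icc (-t₀) t₀,
      β * ((duhamel β (K - (s : ℂ) • N) N N).re - m s ^ 2) ≤ β * V := by
    intro s hs
    have hKs : (K - (s : ℂ) • N).IsHermitian := isHermitian_sub_smul hK hN s
    have hd := re_duhamel_conjTranspose_le hKs N β
    rw [hN.eq] at hd
    have hv := hvar s hs
    have h1 : (duhamel β (K - (s : ℂ) • N) N N).re - m s ^ 2 ≤ V := by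
      simp only [hm_def]; linarith
    exact mul_le_mul_of_nonneg_left h1 hβ.le
  -- mean value inequality for `m` on `[-t, t]`
  have hmvt : m t - m (-t) ≤ β * V * (t - -t) := by
    have hcont : ContinuousOn m (Set.Icc (-t₀) t₀) := fun s _ =>
      (hm' s).continuousAt.continuousWithinAt
    have hdiff : DifferentiableOn ℝ m (interior (Set.Icc (-t₀) t₀)) := fun s _ =>
      (hm' s).differentiableAt.differentiableWithinAt
    have hle : ∀ s ∈ interior (Set.Icc (-t₀) t₀), deriv m s ≤ β * V := by
      intro s hs
      rw [interior_Icc] at hs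
      rw [(hm' s).deriv]
      exact hbound s ⟨hs.1.le, hs.2.le⟩
    exact (convex_Icc (-t₀) t₀).image_sub_le_mul_sub_of_deriv_le hcont hdiff hle (-t)
      ⟨by linarith, by linarith⟩ t ⟨by linarith, htt⟩ (by linarith)
  -- Peierls–Bogoliubov at the two shifted Hamiltonians
  have hKt : (K - (t : ℂ) • N).IsHermitian := isHermitian_sub_smul hK hN t
  have hKmt : (K - ((-t : ℝ) : ℂ) • N).IsHermitian := isHermitian_sub_smul hK hN (-t)
  have hW1 : ((t : ℂ) • N).IsHermitian := by
    have := hK.sub hKt; rwa [sub_sub_cancel] at this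
  have hW2 : (((-t : ℝ) : ℂ) • N).IsHermitian := by
    have := hK.sub hKmt; rwa [sub_sub_cancel] at this
  have pb1 := log_partitionFn_sub_le_log_partitionFn_add hKt hW1 β
  have pb2 := log_partitionFn_sub_le_log_partitionFn_add hKmt hW2 β
  rw [sub_add_cancel, map_smul, smul_eq_mul, Complex.re_ofReal_mul] at pb1 pb2
  -- pb1 : log Z(K_t) - β (t m(t)) ≤ log Z(K); pb2 : log Z(K_{-t}) - β ((-t) m(-t)) ≤ log Z(K)
  have hsum : Real.log (partitionFn β (K - (t : ℂ) • N)).re +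
        Real.log (partitionFn β (K - ((-t : ℝ) : ℂ) • N)).re -
      2 * Real.log (partitionFn β K).re ≤ β * t * (m t - m (-t)) := by
    have e1 : (gibbsState β (K - (t : ℂ) • N) N).re = m t := rfl
    have e2 : (gibbsState β (K - ((-t : ℝ) : ℂ) • N) N).re = m (-t) := rfl
    rw [e1] at pb1
    rw [e2] at pb2
    nlinarith
  have hβt : 0 ≤ β * t := by positivity
  calc Real.log (partitionFn β (K - (t : ℂ) • N)).re +
        Real.log (partitionFn β (K - ((-t : ℝ) : ℂ) • N)).re - 2 * Real.log (partitionFn β K).re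
      ≤ β * t * (m t - m (-t)) := hsum
    _ ≤ β * t * (β * V * (t - -t)) := mul_le_mul_of_nonneg_left hmvt hβt
    _ = 2 * β ^ 2 * V * t ^ 2 := by ring

/-! ### The sourced torus: number variance `≤ C L²` ⟹ pressure second differences `≤ 2βC t²` -/

/-- Shifting the chemical potential of the sourced torus Hamiltonian subtracts a multiple of `N̂`:
`H_L(μ + s) = H_L(μ) − s N̂`. [folklore] -/
theorem nvc_dWaveSourceTorus_add (L : ℕ) [NeZero L] (U μ s h : ℝ) :
    dWaveSourceTorus L U (μ + s) h = dWaveSourceTorus L U μ h - (s : ℂ) • totalNumber := by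
  have e := cfb_dWaveSourceTorus_sub_mu L U μ (μ + s) h
  rw [show μ + s - μ = s by ring] at e
  rw [← e, sub_sub_cancel]

/-- **Number variance bounds the compressibility of the sourced torus.** If
`Re⟨N̂²⟩_{μ'} − (Re⟨N̂⟩_{μ'})² ≤ C L²` for the Gibbs state of `dWaveSourceTorus L U μ' h` at inverse
temperature `β > 0`, for all `μ' ∈ [μ − t₀, μ + t₀]`, then for `0 < t ≤ t₀` the sourced pressure
`p̃_L(μ') = log Z/(βL²)` satisfies `p̃_L(μ+t) + p̃_L(μ−t) − 2p̃_L(μ) ≤ 2βC t²`. [folklore composition] -/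
theorem nvc_sourcedPressure_second_difference_le (L : ℕ) [NeZero L] (U μ h : ℝ) {β : ℝ} (hβ : 0 < β)
    {C t₀ : ℝ}
    (hvar : ∀ μ' ∈ Set.Icc (μ - t₀) (μ + t₀),
      (gibbsState β (dWaveSourceTorus L U μ' h) (totalNumber * totalNumber)).re -
          (gibbsState β (dWaveSourceTorus L U μ' h) totalNumber).re ^ 2 ≤ C * (L : ℝ) ^ 2)
    {t : ℝ} (ht : 0 < t) (htt : t ≤ t₀) :
    Real.log (partitionFn β (dWaveSourceTorus L U (μ + t) h)).re / (β * (L : ℝ) ^ 2) +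
        Real.log (partitionFn β (dWaveSourceTorus L U (μ - t) h)).re / (β * (L : ℝ) ^ 2) -
      2 * (Real.log (partitionFn β (dWaveSourceTorus L U μ h)).re / (β * (L : ℝ) ^ 2)) ≤
      2 * β * C * t ^ 2 := by
  have hL := cast_sq_pos_of_neZero L
  have hβL : 0 < β * (L : ℝ) ^ 2 := mul_pos hβ hL
  have hK := dWaveSourceTorus_isHermitian L (isHermitian_hubbardTorusWith L 1 U μ) h
  have hN : (totalNumber : Matrix (Finset (Orb (FermionTorus 2 L))) _ ℂ).IsHermitian :=
    totalNumber_isHermitian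
  have hvar' : ∀ s ∈ Set.Icc (-t₀) t₀,
      (gibbsState β (dWaveSourceTorus L U μ h - (s : ℂ) • totalNumber) (totalNumber * totalNumber)).re -
          (gibbsState β (dWaveSourceTorus L U μ h - (s : ℂ) • totalNumber) totalNumber).re ^ 2 ≤
        C * (L : ℝ) ^ 2 := by
    intro s hs
    rw [← nvc_dWaveSourceTorus_add]
    exact hvar (μ + s) ⟨by linarith [hs.1], by linarith [hs.2]⟩
  have key := nvc_log_partitionFn_second_difference_le hK hN hβ hvar' ht htt
  rw [← nvc_dWaveSourceTorus_add, ← nvc_dWaveSourceTorus_add, show μ + -t = μ - t by ring] at key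
  rw [← add_div, mul_div_assoc', ← sub_div, div_le_iff₀ hβL]
  calc Real.log (partitionFn β (dWaveSourceTorus L U (μ + t) h)).re +
        Real.log (partitionFn β (dWaveSourceTorus L U (μ - t) h)).re -
        2 * Real.log (partitionFn β (dWaveSourceTorus L U μ h)).re
      ≤ 2 * β ^ 2 * (C * (L : ℝ) ^ 2) * t ^ 2 := key
    _ = 2 * β * C * t ^ 2 * (β * (L : ℝ) ^ 2) := by ring

/-! ### VAR_DIFF ⟹ E_DIFF ⟹ DIFF, and the crux from VAR_DIFF + SCONC -/

/-- **VAR_DIFF ⟹ E_DIFF**: a uniform-in-`L` bound `C L²` on the number variance of the cold sourced Gibbs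
state, locally uniformly in `μ`, gives the uniform-in-`L` second-difference bound of the sourced pressure
(hypothesis of `sdc_stub_sourcedColdDiff_of_compressibility`), with `M = 2βC`, `β = e^{a/U}`.
[folklore composition] -/
theorem nvc_compressibility_of_numberVariance :
    (∀ (μ₁ μ₂ : ℝ), -4 < μ₁ → μ₁ < μ₂ → μ₂ < 0 → ∃ a₀ : ℝ, 0 < a₀ ∧ ∀ a ∈ Set.Ioc (0 : ℝ) a₀,
      ∃ K' U₀ : ℝ, 0 < K' ∧ 0 < U₀ ∧ ∀ U ∈ Set.Ioc (0 : ℝ) U₀, ∀ g ∈ Set.Icc (K' * U) (1 / 10),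
        ∀ μ ∈ Set.Ioo μ₁ μ₂, ∀ h ∈ Set.Icc (-(13 * g + 1)) (13 * g + 1),
          ∃ C t₀ : ℝ, 0 < t₀ ∧ ∃ L₀ : ℕ, ∀ (L : ℕ) [NeZero L], L₀ ≤ L →
            ∀ μ' ∈ Set.Icc (μ - t₀) (μ + t₀),
              (Matrix.gibbsState (Real.exp (a / U)) (dWaveSourceTorus L U μ' h)
                    (totalNumber * totalNumber)).re -
                  (Matrix.gibbsState (Real.exp (a / U)) (dWaveSourceTorus L U μ' h) totalNumber).re ^ 2 ≤
                C * (L : ℝ) ^ 2) →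
    ∀ (μ₁ μ₂ : ℝ), -4 < μ₁ → μ₁ < μ₂ → μ₂ < 0 → ∃ a₀ : ℝ, 0 < a₀ ∧ ∀ a ∈ Set.Ioc (0 : ℝ) a₀,
      ∃ K' U₀ : ℝ, 0 < K' ∧ 0 < U₀ ∧ ∀ U ∈ Set.Ioc (0 : ℝ) U₀, ∀ g ∈ Set.Icc (K' * U) (1 / 10),
        ∀ μ ∈ Set.Ioo μ₁ μ₂, ∀ h ∈ Set.Icc (-(13 * g + 1)) (13 * g + 1),
          ∃ M t₀ : ℝ, 0 < t₀ ∧ ∃ L₀ : ℕ, ∀ (L : ℕ) [NeZero L], L₀ ≤ L → ∀ t : ℝ, 0 < t → t ≤ t₀ →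
            Real.log (Matrix.partitionFn (Real.exp (a / U)) (dWaveSourceTorus L U (μ + t) h)).re /
                  (Real.exp (a / U) * (L : ℝ) ^ 2) +
                Real.log (Matrix.partitionFn (Real.exp (a / U)) (dWaveSourceTorus L U (μ - t) h)).re /
                  (Real.exp (a / U) * (L : ℝ) ^ 2) -
              2 * (Real.log (Matrix.partitionFn (Real.exp (a / U)) (dWaveSourceTorus L U μ h)).re /
                  (Real.exp (a / U) * (L : ℝ) ^ 2)) ≤ M * t ^ 2 := by
  intro hV μ₁ μ₂ h4 h12 h0
  obtain ⟨a₀, ha₀, hA⟩ := hV μ₁ μ₂ h4 h12 h0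
  refine ⟨a₀, ha₀, fun a ha => ?_⟩
  obtain ⟨K', U₀, hK', hU₀, hB⟩ := hA a ha
  refine ⟨K', U₀, hK', hU₀, fun U hU g hg μ hμ h hh => ?_⟩
  obtain ⟨C, t₀, ht₀, L₀, hL₀⟩ := hB U hU g hg μ hμ h hh
  refine ⟨2 * Real.exp (a / U) * C, t₀, ht₀, L₀, fun L _ hL t ht htt => ?_⟩
  exact nvc_sourcedPressure_second_difference_le L U μ h (Real.exp_pos _) (hL₀ L hL) ht htt

/-- **VAR_DIFF ⟹ DIFF (`stub_sourcedColdDiff`, registered signature verbatim)**: normal number fluctuations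
of the cold sourced torus (variance `≤ C L²`, locally uniformly in `μ`, uniformly in large `L`) imply the
`μ`-differentiability of every pointwise thermodynamic limit of the sourced pressure on the open window.
[folklore composition] -/
theorem nvc_stub_sourcedColdDiff_of_numberVariance :
    (∀ (μ₁ μ₂ : ℝ), -4 < μ₁ → μ₁ < μ₂ → μ₂ < 0 → ∃ a₀ : ℝ, 0 < a₀ ∧ ∀ a ∈ Set.Ioc (0 : ℝ) a₀,
      ∃ K' U₀ : ℝ, 0 < K' ∧ 0 < U₀ ∧ ∀ U ∈ Set.Ioc (0 : ℝ) U₀, ∀ g ∈ Set.Icc (K' * U) (1 / 10),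
        ∀ μ ∈ Set.Ioo μ₁ μ₂, ∀ h ∈ Set.Icc (-(13 * g + 1)) (13 * g + 1),
          ∃ C t₀ : ℝ, 0 < t₀ ∧ ∃ L₀ : ℕ, ∀ (L : ℕ) [NeZero L], L₀ ≤ L →
            ∀ μ' ∈ Set.Icc (μ - t₀) (μ + t₀),
              (Matrix.gibbsState (Real.exp (a / U)) (dWaveSourceTorus L U μ' h)
                    (totalNumber * totalNumber)).re -
                  (Matrix.gibbsState (Real.exp (a / U)) (dWaveSourceTorus L U μ' h) totalNumber).re ^ 2 ≤
                C * (L : ℝ) ^ 2) →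
    ∀ (μ₁ μ₂ : ℝ), -4 < μ₁ → μ₁ < μ₂ → μ₂ < 0 → ∃ a₀ : ℝ, 0 < a₀ ∧ ∀ a ∈ Set.Ioc (0 : ℝ) a₀,
      ∃ K' U₀ : ℝ, 0 < K' ∧ 0 < U₀ ∧ ∀ U ∈ Set.Ioc (0 : ℝ) U₀, ∀ g ∈ Set.Icc (K' * U) (1 / 10),
        ∀ q : ℝ → ℝ → ℝ,
          (∀ μ ∈ Set.Icc μ₁ μ₂, ∀ h ∈ Set.Icc (-(13 * g + 1)) (13 * g + 1), ∀ κ : ℝ, 0 < κ →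
            ∃ L₀ : ℕ, ∀ (L : ℕ) [NeZero L], L₀ ≤ L →
              |Real.log (Matrix.partitionFn (Real.exp (a / U)) (dWaveSourceTorus L U μ h)).re /
                  (Real.exp (a / U) * (L : ℝ) ^ 2) - q μ h| ≤ κ) →
          ∀ μ ∈ Set.Ioo μ₁ μ₂, ∀ h ∈ Set.Icc (-(13 * g + 1)) (13 * g + 1),
            DifferentiableAt ℝ (fun μ' => q μ' h) μ := fun hV =>
  sdc_stub_sourcedColdDiff_of_compressibility (nvc_compressibility_of_numberVariance hV)

/-- **Crux R from normal number fluctuations and strict `s`-concavity at the cold slice**: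
VAR_DIFF → SCONC → `ThermalWedge.TwSeededEnsembleEquivalenceR` (`twR_of_coldDiff_coldUniq` ∘
(`nvc_stub_sourcedColdDiff_of_numberVariance`, `usc_stub_sourcedColdUniq_of_strictConcavity`)).
[folklore composition] -/
theorem twR_of_numberVariance_strictConcavity :
    (∀ (μ₁ μ₂ : ℝ), -4 < μ₁ → μ₁ < μ₂ → μ₂ < 0 → ∃ a₀ : ℝ, 0 < a₀ ∧ ∀ a ∈ Set.Ioc (0 : ℝ) a₀,
      ∃ K' U₀ : ℝ, 0 < K' ∧ 0 < U₀ ∧ ∀ U ∈ Set.Ioc (0 : ℝ) U₀, ∀ g ∈ Set.Icc (K' * U) (1 / 10),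
        ∀ μ ∈ Set.Ioo μ₁ μ₂, ∀ h ∈ Set.Icc (-(13 * g + 1)) (13 * g + 1),
          ∃ C t₀ : ℝ, 0 < t₀ ∧ ∃ L₀ : ℕ, ∀ (L : ℕ) [NeZero L], L₀ ≤ L →
            ∀ μ' ∈ Set.Icc (μ - t₀) (μ + t₀),
              (Matrix.gibbsState (Real.exp (a / U)) (dWaveSourceTorus L U μ' h)
                    (totalNumber * totalNumber)).re -
                  (Matrix.gibbsState (Real.exp (a / U)) (dWaveSourceTorus L U μ' h) totalNumber).re ^ 2 ≤
                C * (L : ℝ) ^ 2) →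
    (∀ (μ₁ μ₂ : ℝ), -4 < μ₁ → μ₁ < μ₂ → μ₂ < 0 → ∃ a₁ : ℝ, 0 < a₁ ∧ ∀ a ∈ Set.Ioc (0 : ℝ) a₁,
      ∃ K' U₀ : ℝ, 0 < K' ∧ 0 < U₀ ∧ ∀ U ∈ Set.Ioc (0 : ℝ) U₀, ∀ g ∈ Set.Icc (K' * U) (1 / 10),
        ∀ q : ℝ → ℝ → ℝ,
          (∀ μ ∈ Set.Icc μ₁ μ₂, ∀ h ∈ Set.Icc (-(13 * g + 1)) (13 * g + 1), ∀ κ : ℝ, 0 < κ →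
            ∃ L₀ : ℕ, ∀ (L : ℕ) [NeZero L], L₀ ≤ L →
              |Real.log (Matrix.partitionFn (Real.exp (a / U)) (dWaveSourceTorus L U μ h)).re /
                  (Real.exp (a / U) * (L : ℝ) ^ 2) - q μ h| ≤ κ) →
          ∀ μ ∈ Set.Ioo μ₁ μ₂,
            StrictConcaveOn ℝ (Set.Icc (0 : ℝ) ((13 * g + 1) ^ 2)) (fun s : ℝ => q μ (Real.sqrt s))) →
    TwSeededEnsembleEquivalenceR := fun hV hS =>
  twR_of_coldDiff_coldUniq (nvc_stub_sourcedColdDiff_of_numberVariance hV)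
    (usc_stub_sourcedColdUniq_of_strictConcavity hS)

end

end Summit.HubbardSuperconductivity.HubbardSuperconductivity.Theorems
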